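import Mathlib.Analysis.Fourier.AddCircleMulti
import Mathlib.MeasureTheory.Measure.Haar.Unique
import Mathlib.MeasureTheory.Integral.IntervalIntegral.Periodic
import Mathlib.MeasureTheory.Function.LpSeminorm.Basic
import Mathlib.LinearAlgebra.Matrix.NonsingularInverse
import Literature.Analysis.FunctionSpaces.FlatTorus
import HarnessLib

/-!
# Integer-matrix endomorphisms of the flat torus are measure preserving

Analysis/FunctionSpaces support file. An integer matrix `M ∈ M_d(ℤ)` acts on the flat torus
`T^d = (ℝ/ℤ)^d` by `(M • x)ₗ = ∑ᵢ M_{li} • xᵢ` (a continuous group endomorphism, the descent of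
`y ↦ My` on `ℝ^d`); when `det M ≠ 0` this endomorphism is surjective and PRESERVES THE HAAR
PROBABILITY MEASURE (its image measure is a left-invariant probability measure, hence Haar
measure itself, by uniqueness). This is the change of variables behind the directed, rescaled
Dirichlet kernels of the intermittent Beltrami flows (Buckmaster–Vicol, Ann. of Math. 189
(2019), §3.2: "the map `x ↦ (λσN_Λ(ξ·x + μt), λσN_Λ A_ξ·x, λσN_Λ(ξ × A_ξ)·x)` is the
composition of a rotation by a rational orthogonal matrix …, a rescaling by `λσN_Λ`, and a
translation … These are all volume preserving transformations on `𝕋³`"; Luo–Titi 2020, §3.2: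
"`⨍ η²_ξ dx = 1`, `‖η_ξ‖_{L^∞_t L^p_x} ≲ r^{3/2-3/p}`") — on the torus the honest statement is
not that an integer matrix of determinant `±(λσN_Λ)³` is a bijection (it is `|det|`-to-one) but
that it preserves Haar measure, which is all that is used (`‖D_r ∘ (M• + v)‖_{L^p} = ‖D_r‖_{L^p}`).

## Contents (all proved)

* `Torus.mulVecT M : UnitAddTorus d →+ UnitAddTorus d`, `Torus.mulVecT_apply`, continuity,
  `Torus.mulVecT_proj` (`M • proj y = proj (My)`);
* `Torus.mulVecT_surjective` (`det M ≠ 0`);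
* `Torus.map_mulVecT_volume`, `Torus.measurePreserving_mulVecT` (`det M ≠ 0`), and the
  consequences `Torus.measurePreserving_mulVecT_add` (`x ↦ M • x + v`),
  `Torus.eLpNorm_comp_mulVecT_add`, `Torus.integral_comp_mulVecT_add`.

## References

* T. Buckmaster, V. Vicol, Ann. of Math. 189 (2019) = arXiv:1709.10033, §3.2 (volume-preserving
  change of variables for `η_ξ`). [`BuckmasterVicol2019AnnMath`]
* T. Luo, E. S. Titi, Calc. Var. PDE 59 (2020) = arXiv:1808.07595, §3.2 (3.3)–(3.4). [`LuoTiti2020`]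
-/

noncomputable section

open MeasureTheory Set Filter Function UnitAddTorus
open scoped ENNReal

namespace Literature.Analysis.FunctionSpaces

namespace Torus

variable {d : Type*} [Fintype d] [DecidableEq d]

/-! ## The endomorphism `x ↦ M • x` -/

/-- **The action of an integer matrix on the torus**: `(M • x)ₗ = ∑ᵢ M_{li} • xᵢ`
(`ℤ`-multiples in `ℝ/ℤ`), an additive group endomorphism of `T^d`. [folklore] -/
def mulVecT (M : Matrix d d ℤ) : UnitAddTorus d →+ UnitAddTorus d where
  toFun x := fun l => ∑ i, M l i • x i
  map_zero' := by funext l; simp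
  map_add' x y := by funext l; simp [Finset.sum_add_distrib]

omit [DecidableEq d] in
/-- Coordinates of `M • x`. [folklore] -/
theorem mulVecT_apply (M : Matrix d d ℤ) (x : UnitAddTorus d) (l : d) :
    mulVecT M x l = ∑ i, M l i • x i := rfl

omit [DecidableEq d] in
/-- `x ↦ M • x` is continuous. [folklore] -/
theorem continuous_mulVecT (M : Matrix d d ℤ) : Continuous (mulVecT (d := d) M) := by
  refine continuous_pi fun l => ?_
  simp only [mulVecT_apply]
  exact continuous_finsetSum _ fun i _ => (continuous_apply i).zsmul _

omit [DecidableEq d] in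
/-- **`M • proj y = proj (M y)`**: the torus action is the descent of the linear action on `ℝ^d`
(with `M` read as a real matrix). [folklore] -/
theorem mulVecT_proj (M : Matrix d d ℤ) (y : EuclideanSpace ℝ d) :
    mulVecT M (proj y) = proj (WithLp.toLp 2 ((M.map (Int.cast : ℤ → ℝ)).mulVec (WithLp.ofLp y))) := by
  funext l
  rw [mulVecT_apply, proj_apply]
  simp only [proj_apply, Matrix.mulVec, dotProduct, Matrix.map_apply]
  have hs : ((∑ i, (M l i : ℝ) * y i : ℝ) : UnitAddCircle) =
      ∑ i, (((M l i : ℝ) * y i : ℝ) : UnitAddCircle) :=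
    map_sum (QuotientAddGroup.mk' (AddSubgroup.zmultiples (1 : ℝ))) (fun i => (M l i : ℝ) * y i) Finset.univ
  rw [hs]
  refine Finset.sum_congr rfl fun i _ => ?_
  rw [← zsmul_eq_mul, AddCircle.coe_zsmul]

omit [DecidableEq d] in
/-- **Surjectivity**: for `det M ≠ 0` every point of the torus is of the form `M • x` (solve
`My = z` over `ℝ`). [folklore] -/
theorem mulVecT_surjective [DecidableEq d] {M : Matrix d d ℤ} (hM : M.det ≠ 0) :
    Surjective (mulVecT (d := d) M) := by
  intro z
  set MR : Matrix d d ℝ := M.map (Int.cast : ℤ → ℝ) with hMR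
  have hdet : MR.det = (M.det : ℝ) := by
    have h := RingHom.map_det (Int.castRingHom ℝ) M
    rw [RingHom.mapMatrix_apply, Int.coe_castRingHom] at h
    exact h.symm
  have hunit : IsUnit MR.det := by
    rw [isUnit_iff_ne_zero, hdet]
    exact_mod_cast hM
  -- lift `z`, solve the real system, project back
  refine ⟨proj (WithLp.toLp 2 (MR⁻¹.mulVec (WithLp.ofLp (repr z)))), ?_⟩
  rw [mulVecT_proj, ← hMR, WithLp.ofLp_toLp, Matrix.mulVec_mulVec, Matrix.mul_nonsing_inv _ hunit,
    Matrix.one_mulVec, WithLp.toLp_ofLp]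
  exact proj_repr z

/-! ## Measure preservation -/

omit [DecidableEq d] in
/-- The image of the Haar probability measure under `x ↦ M • x`, `det M ≠ 0`, is the Haar
probability measure (an invariant probability measure on the compact torus is unique). [folklore] -/
theorem map_mulVecT_volume [DecidableEq d] {M : Matrix d d ℤ} (hM : M.det ≠ 0) :
    Measure.map (mulVecT M) (volume : Measure (UnitAddTorus d)) = volume := by
  have hcont := continuous_mulVecT (d := d) M
  have hsurj := mulVecT_surjective (d := d) hM
  haveI : Measure.IsAddHaarMeasure (Measure.map (mulVecT M) (volume : Measure (UnitAddTorus d))) :=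
    Measure.isAddHaarMeasure_map_of_isFiniteMeasure (μ := volume) (mulVecT M) hcont hsurj
  -- uniqueness of Haar measure up to a scalar, and both are probability measures
  have h := Measure.isAddLeftInvariant_eq_smul (Measure.map (mulVecT M) (volume : Measure (UnitAddTorus d))) volume
  have huniv : Measure.map (mulVecT M) (volume : Measure (UnitAddTorus d)) univ = 1 := by
    rw [Measure.map_apply hcont.measurable MeasurableSet.univ, preimage_univ, measure_univ]
  have hc : Measure.addHaarScalarFactor (Measure.map (mulVecT M) (volume : Measure (UnitAddTorus d))) volume = 1 := by
    have h1 := congrArg (fun ν : Measure (UnitAddTorus d) => ν univ) h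
    simp only [Measure.smul_apply, measure_univ, huniv] at h1
    have h2 : ((Measure.addHaarScalarFactor (Measure.map (mulVecT M) volume) volume : ℝ≥0∞)) = 1 := by
      simpa [ENNReal.smul_def] using h1.symm
    exact_mod_cast h2
  rw [h, hc, one_smul]

omit [DecidableEq d] in
/-- **`x ↦ M • x` is measure preserving on `T^d` for `det M ≠ 0`.** [folklore] -/
theorem measurePreserving_mulVecT [DecidableEq d] {M : Matrix d d ℤ} (hM : M.det ≠ 0) :
    MeasurePreserving (mulVecT M) (volume : Measure (UnitAddTorus d)) volume :=
  ⟨(continuous_mulVecT M).measurable, map_mulVecT_volume hM⟩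

omit [DecidableEq d] in
/-- **The affine maps `x ↦ M • x + v` are measure preserving** (`det M ≠ 0`) — BV19's
"volume preserving transformations on `𝕋³`". [cite: BuckmasterVicol2019AnnMath, §3.2] -/
theorem measurePreserving_mulVecT_add [DecidableEq d] {M : Matrix d d ℤ} (hM : M.det ≠ 0)
    (v : UnitAddTorus d) :
    MeasurePreserving (fun x => mulVecT M x + v) (volume : Measure (UnitAddTorus d)) volume :=
  (measurePreserving_add_right volume v).comp (measurePreserving_mulVecT hM)

omit [DecidableEq d] in
/-- **`L^p` norms are invariant under `x ↦ M • x + v`** (`det M ≠ 0`): `‖g(M• + v)‖_{L^p} =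
‖g‖_{L^p}` — the identity "`‖η_ξ‖_{L^p(𝕋³)} = ‖D_r‖_{L^p}`" behind Luo–Titi (3.4) / BV19 (3.9).
[cite: BuckmasterVicol2019AnnMath, §3.2] -/
theorem eLpNorm_comp_mulVecT_add [DecidableEq d] {F : Type*} [NormedAddCommGroup F]
    {M : Matrix d d ℤ} (hM : M.det ≠ 0) (v : UnitAddTorus d) {g : UnitAddTorus d → F}
    (hg : AEStronglyMeasurable g volume) (p : ℝ≥0∞) :
    eLpNorm (fun x => g (mulVecT M x + v)) p volume = eLpNorm g p volume :=
  eLpNorm_comp_measurePreserving hg (measurePreserving_mulVecT_add hM v)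

omit [DecidableEq d] in
/-- **Integrals are invariant under `x ↦ M • x + v`** (`det M ≠ 0`): `∫ g(M• + v) = ∫ g` — the
identity behind "`⨍ η²_ξ dx = 1`" (from `∫ D_r² = 1`). [cite: LuoTiti2020, §3.2 (3.4)] -/
theorem integral_comp_mulVecT_add [DecidableEq d] {F : Type*} [NormedAddCommGroup F] [NormedSpace ℝ F]
    {M : Matrix d d ℤ} (hM : M.det ≠ 0) (v : UnitAddTorus d) (g : UnitAddTorus d → F)
    (hg : AEStronglyMeasurable g volume) :
    ∫ x, g (mulVecT M x + v) = ∫ x, g x := by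
  have h := measurePreserving_mulVecT_add hM v
  have hg' : AEStronglyMeasurable g (Measure.map (fun x => mulVecT M x + v) volume) := by
    rw [h.map_eq]; exact hg
  rw [← integral_map h.measurable.aemeasurable hg', h.map_eq]

end Torus

end Literature.Analysis.FunctionSpaces
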